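import Literature.AlgebraicGeometry.Frobenioids.PrimesEquivWeak
import Literature.AlgebraicGeometry.Frobenioids.PrimesEquivBaseIso
import Literature.AlgebraicGeometry.Frobenioids.Thm42DivIdentityPreserved
import HarnessLib

/-!
# [FrdI] Theorem 4.2 (i): `Ψ` preserves Div-identity endomorphisms — for WEAKLY perf-factorial divisor monoids
# (perfect-type setting, explicit hypotheses)

Mochizuki, *The geometry of Frobenioids I: the general theory*, Kyushu J. Math. **62** (2008) 293–400, §4,
Theorem 4.2 (i), statement p. 77, proof p. 81 ll. 5–31 (kurims) [cite: MochizukiFrdI2008, Thm. 4.2 (i) p.81];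
Thm. 4.2 (ii), functoriality of `Ψ^Prime` p. 80 ll. 44–45 [cite: MochizukiFrdI2008, Thm. 4.2 (ii) p.80].

PROOF-ONLY file (cell abc-iut, layer L1, node `FrdI:Thm4.2`; seat abc-iut-L1-t12, row «Thm. 4.2 chain over
`IsPerfFactorialWeak`», L1-lead R129).  Verbatim ports, with `Objectwise IsPerfFactorial` replaced by
`Objectwise IsPerfFactorialWeak` and the fields of the hypothesis structure `FrdI.T42.Setting` (whose
`perfFactorial_i` fields are the printed notion and stay untouched) passed as EXPLICIT hypotheses:
* `PreFrobenioid.primesEquiv_naturality_baseIso_mem_weak` — functoriality of `Ψ^Prime` on `C^{bs-iso}` (Prop. 1.7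
  (ii): base-isomorphism = Frobenius-type `≫` pre-step; port of `PrimesEquivBaseIso.lean`, seat abc-iut-w4-d090; the
  Frobenius-type half `primesEquiv_naturality_frobeniusType_mem` of abc-iut-L1-t2 uses no perf-factoriality);
* `FrdI.T42.isDivIdentity_map_weak` — "`Ψ` preserves Div-identity endomorphisms" (p. 81 ll. 5–31; port of
  `FrdI.T42.isDivIdentity_map`, seat abc-iut-w4-d068): Frobenioids of perfect and isotropic type, `Φ_i` weakly
  perf-factorial, `Φ₂` non-dilating, `Ψ`, `Ψ⁻¹` preserving pre-steps and primary pre-steps, `Ψ` preserving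
  morphisms of Frobenius type and pull-back morphisms (Thm. 3.4 (ii)(iii), Thm. 4.2 (i) primary steps).
No new definitions; no landed declaration touched; nothing of the paper restated or strengthened.  HONEST FRAMING:
classical [FrdI] §4 algebra; nothing here bears on [IUTchIII] Cor. 3.12.
-/

namespace Literature.AlgebraicGeometry.Frobenioids

open CategoryTheory Opposite

/-! ### Functoriality of `Ψ^Prime` on `C^{bs-iso}`, weak hypothesis -/

namespace PreFrobenioid

universe w v v' u u' w₂ v₂ v₂' u₂ u₂'

variable {D : Type u} [Category.{v} D] {Φ : Dᵒᵖ ⥤ CommMonCat.{w}}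
  {C : Type u'} [Category.{v'} C] {F : C ⥤ ElemFrobenioid Φ}
  {D₂ : Type u₂} [Category.{v₂} D₂] {Φ₂ : D₂ᵒᵖ ⥤ CommMonCat.{w₂}}
  {C₂ : Type u₂'} [Category.{v₂'} C₂] {F₂ : C₂ ⥤ ElemFrobenioid Φ₂} (Ψ : C ≌ C₂)

set_option backward.isDefEq.respectTransparency false in
/-- **Theorem 4.2 (ii), functoriality of `Ψ^Prime` on `C^{bs-iso}`, weakly perf-factorial divisor monoids** ("it
suffices to check it with respect to morphisms of Frobenius type and pre-steps [cf. Proposition 1.7, (ii)]", FrdI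
p. 80 ll. 44–45): for EVERY base-isomorphism `γ : A → A'`, primes corresponding under `Φ₁(Base γ)` are carried by `e`
to primes corresponding under `Φ₂(Base (Ψ γ))` — port of `primesEquiv_naturality_baseIso_mem` (seat abc-iut-w4-d090).
[cite: MochizukiFrdI2008, Thm. 4.2 (ii) p.80] -/
theorem primesEquiv_naturality_baseIso_mem_weak (hF : IsFrobenioid F) (hF₂ : IsFrobenioid F₂)
    (hperf : IsOfPerfectType F) (hperf₂ : IsOfPerfectType F₂) (histr : IsOfIsotropicType F)
    (histr₂ : IsOfIsotropicType F₂) (hpf : Objectwise (fun M _ => IsPerfFactorialWeak M) Φ)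
    (hpf₂ : Objectwise (fun M _ => IsPerfFactorialWeak M) Φ₂)
    (hpre : ∀ ⦃X Y : C⦄ (φ : X ⟶ Y), IsPreStep F φ → IsPreStep F₂ (Ψ.functor.map φ))
    (hpre' : ∀ ⦃X Y : C₂⦄ (φ : X ⟶ Y), IsPreStep F₂ φ → IsPreStep F (Ψ.inverse.map φ))
    (hfrob : ∀ ⦃X Y : C⦄ (φ : X ⟶ Y), IsFrobeniusType F φ → IsFrobeniusType F₂ (Ψ.functor.map φ))
    (hprim : ∀ ⦃X Y : C⦄ (φ : X ⟶ Y), IsPrimaryPreStep F φ → IsPrimaryPreStep F₂ (Ψ.functor.map φ))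
    (e : ∀ A : C, Primes (Φ.obj (op (baseObj F A))) ≃ Primes (Φ₂.obj (op (baseObj F₂ (Ψ.functor.obj A)))))
    (he : ∀ (A : C) ⦃E : C⦄ (ε : E ⟶ A) (hε : IsPrimaryPreStep F ε) (𝔭 : Primes (Φ.obj (op (baseObj F A)))),
      invDiv F ε hε.1.2 ∈ 𝔭.carrier → ∀ h₂ : IsBaseIso F₂ (Ψ.functor.map ε),
        invDiv F₂ (Ψ.functor.map ε) h₂ ∈ (e A 𝔭).carrier)
    {A A' : C} (γ : A ⟶ A') (hγ : IsBaseIso F γ)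
    (𝔭 : Primes (Φ.obj (op (baseObj F A)))) (𝔭' : Primes (Φ.obj (op (baseObj F A'))))
    (hrel : ∃ p' ∈ 𝔭'.carrier, pull Φ (Base F γ) p' ∈ 𝔭.carrier) :
    ∃ q' ∈ (e A' 𝔭').carrier, pull Φ₂ (Base F₂ (Ψ.functor.map γ)) q' ∈ (e A 𝔭).carrier := by
  obtain ⟨p', hp', hpp'⟩ := hrel
  obtain ⟨X, β, α, hfac, hβ, hα⟩ := (isBaseIso_iff_exists_frobeniusType_preStep F hF γ).mp hγ
  haveI : IsIso (Base F α) := hα.2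
  haveI : IsIso (Base F β) := hβ.2
  have hpXprim : IsPrimary (pull Φ (Base F α) p') := (isPrimary_pull_iff (Base F α) p').mpr hp'.1
  let 𝔭X : Primes (Φ.obj (op (baseObj F X))) := Quotient.mk _ ⟨pull Φ (Base F α) p', hpXprim⟩
  have hpX : pull Φ (Base F α) p' ∈ 𝔭X.carrier := mem_carrier_mk_of_isPrimary hpXprim
  have hppX : pull Φ (Base F β) (pull Φ (Base F α) p') ∈ 𝔭.carrier := by
    rw [← pull_comp, ← base_comp, hfac]
    exact hpp'
  obtain ⟨q', hq', hq'X⟩ := primesEquiv_naturality_preStep_mem_weak Ψ hF hF₂ hperf hperf₂ histr histr₂ hpf hpf₂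
    hpre hpre' e he α hα 𝔭X 𝔭' ⟨p', hp', hpX⟩
  obtain ⟨y, hy, hyA⟩ := primesEquiv_naturality_frobeniusType_mem Ψ.functor hF hF₂ hfrob
    (fun E ε hε => hprim ε hε) (fun E ε hε => hprim ε hε) (e X) (e A)
    (fun E ε hε 𝔮 h => he X ε hε 𝔮 h (hprim ε hε).1.2) (fun E ε hε 𝔮 h => he A ε hε 𝔮 h (hprim ε hε).1.2)
    β hβ 𝔭X 𝔭 ⟨pull Φ (Base F α) p', hpX, hppX⟩
  refine ⟨q', hq', ?_⟩
  haveI : IsIso (Base F₂ (Ψ.functor.map β)) := (hfrob β hβ).2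
  obtain ⟨eβ, heβ⟩ := exists_mulEquiv_pull (Φ := Φ₂) (Base F₂ (Ψ.functor.map β))
  rw [← hfac, Functor.map_comp, base_comp, pull_comp, ← heβ]
  exact Primes.map_mem_carrier_of_mem eβ hy (by rw [heβ]; exact hyA) hq'X

end PreFrobenioid

/-! ### `Ψ` preserves Div-identity endomorphisms, weak hypothesis -/

namespace FrdI.T42

universe w v v' u u'

variable {D₁ : Type u} [Category.{v} D₁] {Φ₁ : D₁ᵒᵖ ⥤ CommMonCat.{w}} {C₁ : Type u'} [Category.{v'} C₁]
  {D₂ : Type u} [Category.{v} D₂] {Φ₂ : D₂ᵒᵖ ⥤ CommMonCat.{w}} {C₂ : Type u'} [Category.{v'} C₂]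
  {F₁ : C₁ ⥤ ElemFrobenioid Φ₁} {F₂ : C₂ ⥤ ElemFrobenioid Φ₂} (Ψ : C₁ ≌ C₂)

set_option backward.isDefEq.respectTransparency false in
/-- **[FrdI] Thm. 4.2 (i), "`Ψ` preserves Div-identity endomorphisms", weakly perf-factorial divisor monoids**
(p. 81 ll. 5–31), with the setting of the proof after its two reductions passed EXPLICITLY: Frobenioids of perfect
and isotropic type, `Φ_i` WEAKLY perf-factorial, `Ψ`, `Ψ⁻¹` preserving pre-steps (Thm. 3.4 (ii)), `Ψ` preserving
morphisms of Frobenius type and pull-back morphisms (Thm. 3.4 (iii)), `Φ₂` non-dilating, and `Ψ`, `Ψ⁻¹` preserving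
primary pre-steps (Thm. 4.2 (i), primary steps): if `α : A → A` is a Div-identity endomorphism then so is `Ψ α`.
Port of `isDivIdentity_map` (seat abc-iut-w4-d068): Def. 1.3 (iv)(a) factorisation `α = γ ≫ δ`, the Prop. 1.11 (v)
square along the pull-back `δ`, `Ψ^Prime` (`existsUnique_primesEquiv_weak`) and its functoriality along the
base-isomorphism `γ` (`primesEquiv_naturality_baseIso_mem_weak`), and non-dilation of `Φ₂`.
[cite: MochizukiFrdI2008, Thm. 4.2 (i) p.81] -/
theorem isDivIdentity_map_weak (hF₁ : PreFrobenioid.IsFrobenioid F₁) (hF₂ : PreFrobenioid.IsFrobenioid F₂)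
    (hperf₁ : PreFrobenioid.IsOfPerfectType F₁) (hperf₂ : PreFrobenioid.IsOfPerfectType F₂)
    (histr₁ : PreFrobenioid.IsOfIsotropicType F₁) (histr₂ : PreFrobenioid.IsOfIsotropicType F₂)
    (hpf₁ : Objectwise (fun M _ => IsPerfFactorialWeak M) Φ₁)
    (hpf₂ : Objectwise (fun M _ => IsPerfFactorialWeak M) Φ₂)
    (hpre : ∀ ⦃X Y : C₁⦄ (φ : X ⟶ Y), PreFrobenioid.IsPreStep F₁ φ → PreFrobenioid.IsPreStep F₂ (Ψ.functor.map φ))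
    (hpre' : ∀ ⦃X Y : C₂⦄ (φ : X ⟶ Y), PreFrobenioid.IsPreStep F₂ φ → PreFrobenioid.IsPreStep F₁ (Ψ.inverse.map φ))
    (hfrob : ∀ ⦃X Y : C₁⦄ (φ : X ⟶ Y),
      PreFrobenioid.IsFrobeniusType F₁ φ → PreFrobenioid.IsFrobeniusType F₂ (Ψ.functor.map φ))
    (hpb : ∀ ⦃X Y : C₁⦄ (φ : X ⟶ Y),
      PreFrobenioid.IsPullbackMorphism F₁ φ → PreFrobenioid.IsPullbackMorphism F₂ (Ψ.functor.map φ))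
    (hnd₂ : IsNonDilatingOn Φ₂)
    (hprim : ∀ ⦃X Y : C₁⦄ (φ : X ⟶ Y), PreFrobenioid.IsPrimaryPreStep F₁ φ →
      PreFrobenioid.IsPrimaryPreStep F₂ (Ψ.functor.map φ))
    (hprim' : ∀ ⦃X Y : C₂⦄ (φ : X ⟶ Y), PreFrobenioid.IsPrimaryPreStep F₂ φ →
      PreFrobenioid.IsPrimaryPreStep F₁ (Ψ.inverse.map φ))
    {A : C₁} (α : A ⟶ A) (hα : PreFrobenioid.IsDivIdentity F₁ α) :
    PreFrobenioid.IsDivIdentity F₂ (Ψ.functor.map α) := by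
  open PreFrobenioid in
  classical
  have hP₂ := hF₂.isPreFrobenioid
  -- the family `e = Ψ^Prime` with its defining property, one object at a time
  have H := fun X : C₁ => existsUnique_primesEquiv_weak Ψ hF₁ hF₂ histr₁ histr₂ hpf₁ hpf₂ hpre hpre' X
    (fun E ε hε => hprim ε hε) (fun Z ξ hξ => hprim' ξ hξ)
  choose e he using fun X => (H X).exists
  have he' : ∀ (X : C₁) ⦃E : C₁⦄ (ε : E ⟶ X) (hε : IsPrimaryPreStep F₁ ε)
      (𝔭 : Primes (Φ₁.obj (op (baseObj F₁ X)))), invDiv F₁ ε hε.1.2 ∈ 𝔭.carrier →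
        ∀ h₂ : IsBaseIso F₂ (Ψ.functor.map ε), invDiv F₂ (Ψ.functor.map ε) h₂ ∈ (e X 𝔭).carrier :=
    fun X E ε hε 𝔭 h _ => he X ε hε 𝔭 h
  -- Def. 1.3 (iv)(a): `α = γ_F ≫ β_p ≫ δ`
  obtain ⟨X, B, γF, βp, δ, hfac, hγF, hβp, hδ⟩ := hF₁.iv_a_exists α
  have hγbase : IsBaseIso F₁ (γF ≫ βp) := by
    haveI : IsIso (Base F₁ γF) := hγF.2
    haveI : IsIso (Base F₁ βp) := hβp.2
    change IsIso (Base F₁ (γF ≫ βp))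
    rw [base_comp]
    infer_instance
  have hfac' : (γF ≫ βp) ≫ δ = α := by rw [Category.assoc]; exact hfac
  refine isDivIdentity_of_exists_precsim hP₂ hnd₂ (Ψ.functor.map α) fun 𝔮 => ?_
  obtain ⟨⟨p, hp⟩, hp𝔭⟩ := Quotient.exists_rep ((e A).symm 𝔮)
  have hpmem : p ∈ ((e A).symm 𝔮).carrier := by rw [← hp𝔭]; exact mem_carrier_mk_of_isPrimary hp
  obtain ⟨A'', ε'', hε'', hε''x⟩ := hF₁.iii_d_over_surj A p
  have hε''prim : IsPrimaryPreStep F₁ ε'' :=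
    isPrimaryPreStep_of_isPrimary_invDiv hε''.2 (by rw [hε''x]; exact hp)
  have hε''mem : invDiv F₁ ε'' hε''.2.2 ∈ ((e A).symm 𝔮).carrier := by rw [hε''x]; exact hpmem
  -- (b) the lower square `ε_B ≫ δ = δ′ ≫ ε″` and its divisor calculus
  obtain ⟨W, εB, δ', hεB, hδ', hsq⟩ := exists_preStep_pullback_square hF₁ histr₁ δ hδ ε'' hε''
  have hxB : invDiv F₁ εB hεB.2.2 = pull Φ₁ (Base F₁ δ) (invDiv F₁ ε'' hε''.2.2) :=
    invDiv_eq_pull_of_pullback_square hF₁ hεB.2 hδ hδ' hε''.2 hsq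
  have hγxB : pull Φ₁ (Base F₁ (γF ≫ βp)) (invDiv F₁ εB hεB.2.2) = invDiv F₁ ε'' hε''.2.2 := by
    rw [hxB, ← pull_comp, ← base_comp, hfac', show pull Φ₁ (Base F₁ α) = MonoidHom.id _ from hα,
      MonoidHom.id_apply]
  have hxBprim : IsPrimary (invDiv F₁ εB hεB.2.2) := by
    haveI : IsIso (Base F₁ (γF ≫ βp)) := hγbase
    have h := isPrimary_invDiv hε''prim
    rw [← hγxB] at h
    exact (isPrimary_pull_iff (Base F₁ (γF ≫ βp)) _).mp h
  have hεBprim : IsPrimaryPreStep F₁ εB := isPrimaryPreStep_of_isPrimary_invDiv hεB.2 hxBprim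
  let 𝔭B : Primes (Φ₁.obj (op (baseObj F₁ B))) := Quotient.mk _ ⟨_, hxBprim⟩
  have hxBmem : invDiv F₁ εB hεB.2.2 ∈ 𝔭B.carrier := mem_carrier_mk_of_isPrimary hxBprim
  -- (c) functoriality of `Ψ^Prime` along the base-isomorphism `γ`
  obtain ⟨q', hq', hq'pull⟩ := primesEquiv_naturality_baseIso_mem_weak Ψ hF₁ hF₂ hperf₁ hperf₂
    histr₁ histr₂ hpf₁ hpf₂ hpre hpre' hfrob hprim e he' (γF ≫ βp) hγbase ((e A).symm 𝔮) 𝔭B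
    ⟨invDiv F₁ εB hεB.2.2, hxBmem, by rw [hγxB]; exact hε''mem⟩
  rw [Equiv.apply_symm_apply] at hq'pull
  -- (d) the square transported by `Ψ` and its divisor calculus in `C₂`
  have hΨεB : IsPreStep F₂ (Ψ.functor.map εB) := hpre εB hεB.2
  have hΨε'' : IsPreStep F₂ (Ψ.functor.map ε'') := hpre ε'' hε''.2
  have hΨsq : Ψ.functor.map εB ≫ Ψ.functor.map δ = Ψ.functor.map δ' ≫ Ψ.functor.map ε'' := by
    rw [← Functor.map_comp, hsq, Functor.map_comp]
  have hxB₂ : invDiv F₂ (Ψ.functor.map εB) hΨεB.2 =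
      pull Φ₂ (Base F₂ (Ψ.functor.map δ)) (invDiv F₂ (Ψ.functor.map ε'') hΨε''.2) :=
    invDiv_eq_pull_of_pullback_square hF₂ hΨεB (hpb δ hδ) (hpb δ' hδ') hΨε'' hΨsq
  have hq : invDiv F₂ (Ψ.functor.map ε'') hΨε''.2 ∈ 𝔮.carrier := by
    have h := he A ε'' hε''prim ((e A).symm 𝔮) hε''mem
    rwa [Equiv.apply_symm_apply] at h
  have hqB : invDiv F₂ (Ψ.functor.map εB) hΨεB.2 ∈ (e B 𝔭B).carrier := he B εB hεBprim 𝔭B hxBmem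
  refine ⟨invDiv F₂ (Ψ.functor.map ε'') hΨε''.2, hq, ?_⟩
  have hcalc : pull Φ₂ (Base F₂ (Ψ.functor.map α)) (invDiv F₂ (Ψ.functor.map ε'') hΨε''.2) =
      pull Φ₂ (Base F₂ (Ψ.functor.map (γF ≫ βp))) (invDiv F₂ (Ψ.functor.map εB) hΨεB.2) := by
    rw [hxB₂, ← pull_comp, ← base_comp, ← Functor.map_comp, hfac']
  rw [hcalc]
  exact (((Primes.precsim_of_mem_carrier _ hqB hq').map _).trans
    (Primes.precsim_of_mem_carrier _ hq'pull hq))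

end FrdI.T42

end Literature.AlgebraicGeometry.Frobenioids
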